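/-
Origin: expansion seat `planner-pub-hodgecm-landherr-g5-0`, handover 2026-08-18T05:36:00Z (`HOME/pub-hodgecm-landherr-g5/lean/LandherrG5/LandherrDischarge.lean`, md5 99775c10, 283 lines);
landed by the gen-6 packager in gate run 23 as `HodgeCM/Proofs/LandherrDischarge.lean` (verbatim).
-/
/-
Copyright: pub-hodgecm formalisation cell (harness21, 2026). New file (not vendored).
Origin: HOME/pub-hodgecm-landherr-g5/lean/LandherrG5/LandherrDischarge.lean — session planner-pub-hodgecm-landherr-g5-0
(unit pub-hodgecm-landherr-g5, EXPANSION part (c) `Lemma33bLandherr`, generation 5).  WIP module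
`LandherrG5.LandherrDischarge`; intended final place `HodgeCM/Proofs/LandherrDischarge.lean`
(module `HodgeCM.Proofs.LandherrDischarge`).  BY-NAME WIRING ONLY: nothing is posited, nothing is cited, no new
`def … : Prop`; every theorem is an existing theorem of the package applied to `HodgeCM.lemma33bLandherr_holds`.
-/
import Summits.HodgeConjecture.HodgeCM.Literature.NormTheoremHolds
import Summits.HodgeConjecture.HodgeCM.Model.ThetaSeparation
import Summits.HodgeConjecture.HodgeCM.PerL34.Assembly
import Summits.HodgeConjecture.HodgeCM.Proofs.SeesawConstruction_2

set_option autoImplicit false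

/-!
# Discharging the hypothesis `(hL : Lemma33bLandherr)` everywhere (gen 5, after gate run 22)

Since gate run 22 the typed target `HodgeCM.Lemma33bLandherr` (`HodgeCM/StubTree/Inputs.lean`, Landherr's
classification of hermitian planes over a CM field = PerL v5 Lemma 3.3(b), tex ll. 299–300) is a THEOREM of the
package: `HodgeCM.lemma33bLandherr_holds` (`HodgeCM/Literature/NormTheoremHolds.lean`, proved over the vendored
harness-tree cone `HodgeCM/Vendored/H21/**` through the norm theorem for quaternion algebras, Vignéras LNM 800
III Thm 4.1 = `HodgeCM.Literature.Vigneras_III_4_1_holds`; closure `[propext, Classical.choice, Quot.sound]`).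

Seventeen theorems / two records of the package still carry `Lemma33bLandherr` as an explicit HYPOTHESIS (they were
written in runs 16–19, before the target was proved).  This file restates each of them WITHOUT that hypothesis, by
application — so that, in particular, the INDEPENDENCE / SEPARATION theorems of `HodgeCM/Model/ThetaSeparation.lean`
and `HodgeCM/Model/NonVacuity.lean` become unconditional relative-consistency statements:

* §1 `HodgeCM.PerL34.N14_landherr_holds` — the carver's DAG node N14 (`HOME/LEMMAS.md`; `PerL34/Allowed.lean`,
  `def N14_landherr : Prop := Lemma33bLandherr`) is PROVED; hence the carver's original node assembly
  `PerL34.perL_of_nodes` with `h14` supplied (`perL_of_nodes_N14`; cf. the construction route `perL_of_nodes''`).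
* §2 the records: `Assembly.OpenInputsTheta'' U T → OpenInputsTheta' U T → OpenInputsTheta U T` (the `landherr`
  and `levelDirected` fields are theorems), so the three records are EQUIVALENT (`openInputsTheta_iff''`,
  `openInputsTheta'_iff''`); the unprimed headline forms `realisationExistsPerL_of`, `realisationExistsFace_of`,
  `COR_CM_theta`, `perL_theta`, `periodThmF_theta` with BOTH residual algebraic inputs supplied
  (suffix `_disch`; they agree with gen 2's constructed `''` forms as propositions — proofs are irrelevant).
* §3 `Model/ThetaSeparation.lean` without `hL`: `exists_goodCtx''`, `drop01_not_thetaWedge''`,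
  `separating_thetaWedge''`, `drop23_not_thetaReal34''`, `separating_thetaReal34''`, `conj02_not_thetaSub''`,
  `separating_thetaSub''`, and the three packaging theorems `exists_model_not_thetaWedge''`,
  `exists_model_not_thetaReal34''`, `exists_model_not_thetaSub''` — "`Open_thetaWedge` / `Open_thetaReal34` /
  `Open_thetaSub` is not derivable from the 28 model facts + `Fact_hodgeRiemann20` + the other nine theta inputs,
  relative to the consistency of the whole list", now with NO side hypothesis.
* §4 `Model/NonVacuity.lean` without `hL`: `periodFree_not_hodgeRiemann_of_thetaWedge''`,
  `periodFree_not_thetaInputs_and_hodgeRiemann''`, `separating_theta''`, `exists_model_not_innerEmb_hodgeRiemann''`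
  — "`Fact_innerEmb` and `Fact_hodgeRiemann20` are not consequences of the rest of the theta-reduced record",
  unconditionally.

Naming: `''` = "Landherr hypothesis discharged", the convention of `HodgeCM/Proofs/SeesawConstruction.lean` (gen 2),
whose `''` theorems discharge it by CONSTRUCTING Def 3.2's seesaw plane; here it is discharged by the THEOREM.  The
Hecke/ball-route forms without `hL` already exist (`HodgeCM/Assembly/CorCMHeckeSeesaw.lean`, run 20) and are not
repeated.  Every statement below is the original statement with the binder `(hL : Lemma33bLandherr)` deleted and
nothing else changed.
-/

noncomputable section

namespace HodgeCM

/-! ## §1 The carver's node N14 is a theorem -/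

namespace PerL34

variable {U : Universe}

/-- **N14 holds** (PerL v5 §3.2, tex ll. 299–300, "Landherr's theorem"): the DAG node `N14_landherr`
(`= HodgeCM.Lemma33bLandherr`) is proved in the package — `HodgeCM.lemma33bLandherr_holds` (run 22). -/
theorem N14_landherr_holds : N14_landherr := lemma33bLandherr_holds

/-- The carver's node assembly `perL_of_nodes` with node N14 supplied by `N14_landherr_holds`: `U.PerL` from the
model axioms, a theta model and ONE hypothesis per REMAINING typed open node (N07, N09a, N09b, N12a, N12b, N19w,
N19g, N29, N31, N33).  Same statement as the construction route `perL_of_nodes''`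
(`HodgeCM/PerL34/AssemblyNoLandherr.lean`). -/
theorem perL_of_nodes_N14 (M : U.ModelAxioms) (T : U.ThetaModel)
    (h07 : N07_hodgeRiemann20 U) (h09a : N09a_embCover T) (h09b : N09b_innerEmb T)
    (h12a : N12a_thetaSub T) (h12b : N12b_signRecipe T)
    (h19w : N19w_wedgeMem T) (h19g : N19g_genInWedgeSpan T) (h29 : N29_occ T) (h31 : N31_chars T)
    (h33 : N33_wedge T) : U.PerL :=
  perL_of_nodes M T h07 h09a h09b h12a h12b N14_landherr_holds h19w h19g h29 h31 h33

end PerL34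

/-! ## §2 The records `OpenInputsTheta ⇔ OpenInputsTheta' ⇔ OpenInputsTheta''` and the unprimed headlines -/

namespace Universe.ThetaModel

variable {U : Universe} (T : U.ThetaModel)

/-- `RealisationExistsPerL` from the theta model (`realisationExistsPerL_of`, run 16) with BOTH residual algebraic
inputs supplied: `LevelDirected` (`HodgeCM.levelDirected`) and `Lemma33bLandherr` (`HodgeCM.lemma33bLandherr_holds`).
Same proposition as gen 2's constructed `realisationExistsPerL_of''`. -/
theorem realisationExistsPerL_of_disch (M : U.ModelAxioms) (A : T.Inputs) (hHR : U.Fact_hodgeRiemann20) :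
    U.RealisationExistsPerL :=
  T.realisationExistsPerL_of M A hHR levelDirected lemma33bLandherr_holds

/-- `RealisationExistsFace` from the theta model (`realisationExistsFace_of`, run 16) with `LevelDirected` and
`Lemma33bLandherr` supplied.  Same proposition as `realisationExistsFace_of''`. -/
theorem realisationExistsFace_of_disch (M : U.ModelAxioms) (A : T.Inputs) (hHR : U.Fact_hodgeRiemann20) :
    U.RealisationExistsFace :=
  T.realisationExistsFace_of M A hHR levelDirected lemma33bLandherr_holds

end Universe.ThetaModel

namespace Assembly

variable (U : Universe)

/-- The `''` record (no `levelDirected`, no `landherr` field) gives the `'` record: the `landherr` field is the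
theorem `lemma33bLandherr_holds`.  Converse of `openInputsTheta''_of`. -/
theorem openInputsTheta'_of'' (T : U.ThetaModel) (I : OpenInputsTheta'' U T) : OpenInputsTheta' U T :=
  ⟨I.theta, I.hodgeRiemann20, lemma33bLandherr_holds, I.pohlmann_span, I.qw8_sufficiency⟩

/-- The `''` record gives the ORIGINAL record `OpenInputsTheta` (run 16): `levelDirected := HodgeCM.levelDirected`,
`landherr := lemma33bLandherr_holds`. -/
theorem openInputsTheta_of'' (T : U.ThetaModel) (I : OpenInputsTheta'' U T) : OpenInputsTheta U T :=
  ⟨I.theta, I.hodgeRiemann20, levelDirected, lemma33bLandherr_holds, I.pohlmann_span, I.qw8_sufficiency⟩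

/-- The three theta-route records of open inputs are equivalent: `OpenInputsTheta' U T ↔ OpenInputsTheta'' U T`. -/
theorem openInputsTheta'_iff'' (T : U.ThetaModel) : OpenInputsTheta' U T ↔ OpenInputsTheta'' U T :=
  ⟨openInputsTheta''_of U T, openInputsTheta'_of'' U T⟩

/-- … and `OpenInputsTheta U T ↔ OpenInputsTheta'' U T`. -/
theorem openInputsTheta_iff'' (T : U.ThetaModel) : OpenInputsTheta U T ↔ OpenInputsTheta'' U T :=
  ⟨fun I => ⟨I.theta, I.hodgeRiemann20, I.pohlmann_span, I.qw8_sufficiency⟩, openInputsTheta_of'' U T⟩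

/-- **COR-CM from the theta model** through the ORIGINAL route `COR_CM_theta` (run 16) with `LevelDirected` and
`Lemma33bLandherr` supplied: remaining named inputs `T.Inputs`, `Fact_hodgeRiemann20`, `PohlmannSpan`,
`Qw8Sufficiency` — the same proposition as `COR_CM_theta''`. -/
theorem COR_CM_theta_disch (M : U.ModelAxioms) (T : U.ThetaModel) (A : T.Inputs) (hHR : U.Fact_hodgeRiemann20)
    (hP : U.PohlmannSpan) (hQ : U.Qw8Sufficiency) : U.HC_CM :=
  COR_CM_theta U M T A hHR levelDirected lemma33bLandherr_holds hP hQ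

/-- **PerL from the theta model** through the original route `perL_theta` with both algebraic inputs supplied. -/
theorem perL_theta_disch (M : U.ModelAxioms) (T : U.ThetaModel) (A : T.Inputs) (hHR : U.Fact_hodgeRiemann20) :
    U.PerL :=
  perL_theta U M T A hHR levelDirected lemma33bLandherr_holds

/-- **rfwf Thm 4.1 from the theta model** through the original route `periodThmF_theta` with both algebraic inputs
supplied. -/
theorem periodThmF_theta_disch (M : U.ModelAxioms) (T : U.ThetaModel) (A : T.Inputs)
    (hHR : U.Fact_hodgeRiemann20) : U.PeriodThmF :=
  periodThmF_theta U M T A hHR levelDirected lemma33bLandherr_holds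

end Assembly

/-! ## §3 `Model/ThetaSeparation.lean` unconditionally -/

namespace Universe.ThetaModel

variable {U : Universe} (T : U.ThetaModel)

/-- A good context exists for every theta model satisfying the two design constraints (cf. `exists_goodCtx`;
Landherr's lemma is now a theorem). -/
theorem exists_goodCtx'' (hκ : T.Design_kappaConj) (hs : T.Design_frameSignConj) :
    ∃ (F : CMField) (ι₁ : F →+* ℂ) (_ : HermSpace3 F ι₁) (c : SeesawCtx F), T.GoodCtx ι₁ c :=
  T.exists_goodCtx hκ hs lemma33bLandherr_holds

/-- `drop01` REFUTES `Open_thetaWedge` (cf. `drop01_not_thetaWedge`), given only the two design constraints. -/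
theorem drop01_not_thetaWedge'' (hκ : T.Design_kappaConj) (hs : T.Design_frameSignConj) :
    ¬ T.drop01.Open_thetaWedge :=
  T.drop01_not_thetaWedge hκ hs lemma33bLandherr_holds

/-- **Separating model for `Open_thetaWedge`, unconditionally** (cf. `separating_thetaWedge`): if `T ⊨ Inputs`
then `T.drop01` satisfies the other nine inputs and refutes Prop 4.3. -/
theorem separating_thetaWedge'' (A : T.Inputs) :
    (T.drop01.Fact_embCover ∧ T.drop01.Fact_innerEmb ∧ T.drop01.Design_kappaConj ∧
      T.drop01.Design_frameSignConj ∧ T.drop01.Open_thetaSub ∧ T.drop01.Open_thetaGen12 ∧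
      T.drop01.Open_thetaReal34 ∧ T.drop01.Open_chars ∧ T.drop01.Open_occ) ∧
    ¬ T.drop01.Open_thetaWedge :=
  T.separating_thetaWedge A lemma33bLandherr_holds

/-- `drop23` refutes `Open_thetaReal34` whenever `(U, T) ⊨ ModelAxioms ∧ Inputs ∧ Fact_hodgeRiemann20`
(cf. `drop23_not_thetaReal34`). -/
theorem drop23_not_thetaReal34'' (M : U.ModelAxioms) (A : T.Inputs) (hHR : U.Fact_hodgeRiemann20) :
    ¬ T.drop23.Open_thetaReal34 :=
  T.drop23_not_thetaReal34 M A hHR lemma33bLandherr_holds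

/-- **Separating model for `Open_thetaReal34`, unconditionally** (cf. `separating_thetaReal34`). -/
theorem separating_thetaReal34'' (M : U.ModelAxioms) (A : T.Inputs) (hHR : U.Fact_hodgeRiemann20) :
    (T.drop23.Fact_embCover ∧ T.drop23.Fact_innerEmb ∧ T.drop23.Design_kappaConj ∧
      T.drop23.Design_frameSignConj ∧ T.drop23.Open_thetaSub ∧ T.drop23.Open_thetaWedge ∧
      T.drop23.Open_thetaGen12 ∧ T.drop23.Open_chars ∧ T.drop23.Open_occ) ∧
    ¬ T.drop23.Open_thetaReal34 :=
  T.separating_thetaReal34 M A hHR lemma33bLandherr_holds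

/-- `conj02` refutes `Open_thetaSub` whenever `U ⊨ Fact_pull_hodge` and `T ⊨ thetaSub ∧ thetaWedge` and the two
design constraints hold (cf. `conj02_not_thetaSub`). -/
theorem conj02_not_thetaSub'' (hH : U.Fact_pull_hodge) (hκ : T.Design_kappaConj) (hs : T.Design_frameSignConj)
    (hsub : T.Open_thetaSub) (hw : T.Open_thetaWedge) : ¬ T.conj02.Open_thetaSub :=
  T.conj02_not_thetaSub hH hκ hs hsub hw lemma33bLandherr_holds

/-- **Separating model for `Open_thetaSub`, unconditionally** (cf. `separating_thetaSub`). -/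
theorem separating_thetaSub'' (hH : U.Fact_pull_hodge) (A : T.Inputs) :
    (T.conj02.Fact_embCover ∧ T.conj02.Fact_innerEmb ∧ T.conj02.Design_kappaConj ∧
      T.conj02.Design_frameSignConj ∧ T.conj02.Open_thetaWedge ∧ T.conj02.Open_thetaGen12 ∧
      T.conj02.Open_thetaReal34 ∧ T.conj02.Open_chars ∧ T.conj02.Open_occ) ∧
    ¬ T.conj02.Open_thetaSub :=
  T.separating_thetaSub hH A lemma33bLandherr_holds

end Universe.ThetaModel

/-- **`Open_thetaWedge` (PerL Prop 4.3, node N33) is not derivable from the rest — unconditionally**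
(cf. `exists_model_not_thetaWedge`): if the 28 model facts, the ten theta inputs and Hodge–Riemann `(2,0)` are
jointly satisfiable, then there are a universe and a theta model satisfying the 28 facts, Hodge–Riemann `(2,0)` and
the other nine theta inputs in which `Open_thetaWedge` FAILS. -/
theorem exists_model_not_thetaWedge''
    (h : ∃ (U : Universe) (T : U.ThetaModel), U.ModelAxioms ∧ T.Inputs ∧ U.Fact_hodgeRiemann20) :
    ∃ (U : Universe) (T : U.ThetaModel), U.ModelAxioms ∧ U.Fact_hodgeRiemann20 ∧
      (T.Fact_embCover ∧ T.Fact_innerEmb ∧ T.Design_kappaConj ∧ T.Design_frameSignConj ∧ T.Open_thetaSub ∧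
        T.Open_thetaGen12 ∧ T.Open_thetaReal34 ∧ T.Open_chars ∧ T.Open_occ) ∧
      ¬ T.Open_thetaWedge :=
  exists_model_not_thetaWedge lemma33bLandherr_holds h

/-- **`Open_thetaReal34` (PerL Lemma 3.5, generation direction, node N19g) is not derivable from the rest —
unconditionally** (cf. `exists_model_not_thetaReal34`). -/
theorem exists_model_not_thetaReal34''
    (h : ∃ (U : Universe) (T : U.ThetaModel), U.ModelAxioms ∧ T.Inputs ∧ U.Fact_hodgeRiemann20) :
    ∃ (U : Universe) (T : U.ThetaModel), U.ModelAxioms ∧ U.Fact_hodgeRiemann20 ∧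
      (T.Fact_embCover ∧ T.Fact_innerEmb ∧ T.Design_kappaConj ∧ T.Design_frameSignConj ∧ T.Open_thetaSub ∧
        T.Open_thetaWedge ∧ T.Open_thetaGen12 ∧ T.Open_chars ∧ T.Open_occ) ∧
      ¬ T.Open_thetaReal34 :=
  exists_model_not_thetaReal34 lemma33bLandherr_holds h

/-- **`Open_thetaSub` (PerL Lemma 3.3(a) + Prop 2.2, node N12a) is not derivable from the rest — unconditionally**
(cf. `exists_model_not_thetaSub`). -/
theorem exists_model_not_thetaSub''
    (h : ∃ (U : Universe) (T : U.ThetaModel), U.ModelAxioms ∧ T.Inputs ∧ U.Fact_hodgeRiemann20) :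
    ∃ (U : Universe) (T : U.ThetaModel), U.ModelAxioms ∧ U.Fact_hodgeRiemann20 ∧
      (T.Fact_embCover ∧ T.Fact_innerEmb ∧ T.Design_kappaConj ∧ T.Design_frameSignConj ∧ T.Open_thetaWedge ∧
        T.Open_thetaGen12 ∧ T.Open_thetaReal34 ∧ T.Open_chars ∧ T.Open_occ) ∧
      ¬ T.Open_thetaSub :=
  exists_model_not_thetaSub lemma33bLandherr_holds h

/-! ## §4 `Model/NonVacuity.lean` unconditionally -/

namespace Universe

variable {U : Universe}

/-- Over the period-free shadow of a model of the 28 facts, for EVERY theta model: the two design constraints,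
`Open_thetaSub` and `Open_thetaWedge` REFUTE Hodge–Riemann in bidegree `(2,0)`
(cf. `periodFree_not_hodgeRiemann_of_thetaWedge`; Landherr's lemma is now a theorem). -/
theorem periodFree_not_hodgeRiemann_of_thetaWedge'' (M : U.ModelAxioms) (T : U.periodFree.ThetaModel)
    (hκ : T.Design_kappaConj) (hs : T.Design_frameSignConj) (hsub : T.Open_thetaSub)
    (hw : T.Open_thetaWedge) : ¬ U.periodFree.Fact_hodgeRiemann20 :=
  periodFree_not_hodgeRiemann_of_thetaWedge M lemma33bLandherr_holds T hκ hs hsub hw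

/-- Hence, over the period-free shadow of a model of the 28 facts, NO theta model satisfies
`Inputs ∧ Fact_hodgeRiemann20` (cf. `periodFree_not_thetaInputs_and_hodgeRiemann`). -/
theorem periodFree_not_thetaInputs_and_hodgeRiemann'' (M : U.ModelAxioms) (T : U.periodFree.ThetaModel) :
    ¬ (T.Inputs ∧ U.periodFree.Fact_hodgeRiemann20) :=
  periodFree_not_thetaInputs_and_hodgeRiemann M lemma33bLandherr_holds T

/-- **Separating model for the pair (`Fact_innerEmb`, `Fact_hodgeRiemann20`), unconditionally**
(cf. `separating_theta`): if `(U, T)` satisfies the 28 facts, the ten theta inputs and Hodge–Riemann `(2,0)`, then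
`(U⁰, T)` satisfies the 28 facts and the NINE trace-free theta inputs and REFUTES both `Fact_innerEmb` and
`Fact_hodgeRiemann20`. -/
theorem separating_theta'' (M : U.ModelAxioms) (T : U.ThetaModel) (A : T.Inputs) (hHR : U.Fact_hodgeRiemann20) :
    U.periodFree.ModelAxioms ∧
    (T.toPeriodFree.Fact_embCover ∧ T.toPeriodFree.Design_kappaConj ∧ T.toPeriodFree.Design_frameSignConj ∧
      T.toPeriodFree.Open_thetaSub ∧ T.toPeriodFree.Open_thetaWedge ∧ T.toPeriodFree.Open_thetaGen12 ∧
      T.toPeriodFree.Open_thetaReal34 ∧ T.toPeriodFree.Open_chars ∧ T.toPeriodFree.Open_occ) ∧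
    ¬ T.toPeriodFree.Fact_innerEmb ∧ ¬ U.periodFree.Fact_hodgeRiemann20 :=
  separating_theta M lemma33bLandherr_holds T A hHR

end Universe

/-- **`Fact_innerEmb` and `Fact_hodgeRiemann20` are not consequences of the rest of the theta-reduced record —
unconditionally** (cf. `exists_model_not_innerEmb_hodgeRiemann`): if the 28 facts, the ten theta inputs and
Hodge–Riemann `(2,0)` are jointly satisfiable, then there are a universe and a theta model satisfying the 28 facts
and the nine trace-free theta inputs in which BOTH `Fact_innerEmb` and `Fact_hodgeRiemann20` fail (and
`RealisationExistsFace`, rfwf Thm 4.1 fail). -/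
theorem exists_model_not_innerEmb_hodgeRiemann''
    (h : ∃ (U : Universe) (T : U.ThetaModel), U.ModelAxioms ∧ T.Inputs ∧ U.Fact_hodgeRiemann20) :
    ∃ (U' : Universe) (T' : U'.ThetaModel), U'.ModelAxioms ∧
      (T'.Fact_embCover ∧ T'.Design_kappaConj ∧ T'.Design_frameSignConj ∧ T'.Open_thetaSub ∧ T'.Open_thetaWedge ∧
        T'.Open_thetaGen12 ∧ T'.Open_thetaReal34 ∧ T'.Open_chars ∧ T'.Open_occ) ∧
      ¬ T'.Fact_innerEmb ∧ ¬ U'.Fact_hodgeRiemann20 ∧ ¬ U'.RealisationExistsFace ∧ ¬ U'.PeriodThmF :=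
  exists_model_not_innerEmb_hodgeRiemann lemma33bLandherr_holds h

end HodgeCM

end
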